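import Mathlib.Topology.Order.LiminfLimsup
import Mathlib.Topology.Instances.Real.Lemmas
import Summits.FinalStateConjecture.FinalStateConjecture.Theses.RecedingSphereBudgets

/-!
# Route RecedingSphereBudgets — `AlmostMonotoneLimit` (card P1)

Support item `stmt-FinalStateConjecture-14742` of route `RecedingSphereBudgets` for the Final State
Conjecture: the elementary real-variable lemma behind the receding-sphere energy budgets
(Martel–Merle–Tsai, *Stability and asymptotic stability in the energy space of the sum of N
solitons for subcritical gKdV equations*, Comm. Math. Phys. 231 (2002), §3, the "almost monotone
functional" step):

> a real function `E` bounded below on `[T, ∞)` with `E t₂ ≤ E t₁ + F t₁` for `T ≤ t₁ ≤ t₂` and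
> `F → 0` has a limit at `+∞`.

Proof: `E` is bounded on `[T, ∞)` (below by `b`, above by `E T + F T`), so its `limsup` and
`liminf` along `atTop` are finite; for every `ε > 0` and every late `t`, `limsup E ≤ E t + ε`,
whence `limsup E − ε ≤ liminf E`; so `limsup E ≤ liminf E` and `E → limsup E`.
Standard material [folklore].
-/

-- every `Summit.FinalStateConjecture.FinalStateConjecture.…` name repeats the summit = sub-problem
-- segment (D-0017 layout, CONVENTIONS §2; lakefile sets it for the library build, a standalone
-- elaboration of this file does not see that option); the duplicate is deliberate.
set_option linter.dupNamespace false

namespace Summit.FinalStateConjecture.FinalStateConjecture.Theorems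

open Filter Topology

/-- **Almost monotone functions bounded below converge** (item `stmt-FinalStateConjecture-14742`,
route decl `Theses.RecedingSphereBudgets.AlmostMonotoneLimit`): if `E : ℝ → ℝ` is bounded below on
`[T, ∞)`, `E t₂ ≤ E t₁ + F t₁` whenever `T ≤ t₁ ≤ t₂`, and `F → 0` at `+∞`, then `E` has a (finite)
limit at `+∞`.  The limit is `limsup E atTop`; the proof is the `limsup ≤ liminf` squeeze. -/
theorem almostMonotoneLimit_proof :
    Summit.FinalStateConjecture.FinalStateConjecture.Theses.RecedingSphereBudgets.AlmostMonotoneLimit := by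
  unfold Summit.FinalStateConjecture.FinalStateConjecture.Theses.RecedingSphereBudgets.AlmostMonotoneLimit
  intro E F T b hb hE hF
  -- `E` is eventually bounded below by `b` and above by `E T + F T`
  have hbdd_le : IsBoundedUnder (· ≤ ·) atTop E :=
    ⟨E T + F T, (eventually_ge_atTop T).mono fun t ht => hE T t le_rfl ht⟩
  have hbdd_ge : IsBoundedUnder (· ≥ ·) atTop E := ⟨b, (eventually_ge_atTop T).mono hb⟩
  refine ⟨limsup E atTop, tendsto_of_le_liminf_of_limsup_le ?_ le_rfl hbdd_le hbdd_ge⟩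
  -- it remains to squeeze: `limsup E ≤ liminf E`
  refine le_of_forall_pos_le_add fun ε hε => ?_
  have key : ∀ᶠ t in atTop, limsup E atTop ≤ E t + ε := by
    filter_upwards [hF.eventually_lt_const hε, eventually_ge_atTop T] with t hFt hTt
    refine limsup_le_of_le hbdd_ge.isCoboundedUnder_le ?_
    filter_upwards [eventually_ge_atTop t] with s hts
    have := hE t s hTt hts
    linarith
  have h : limsup E atTop - ε ≤ liminf E atTop :=
    le_liminf_of_le hbdd_le.isCoboundedUnder_ge (key.mono fun t ht => by linarith)
  linarith

end Summit.FinalStateConjecture.FinalStateConjecture.Theorems
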